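import Mathlib
import Summits.ABC.ABC.Statement
import HarnessLib

/-!
# The odd-prime-exponent corner of shape C forces a Fermat prime (solo-blind seat, session 5)

Shape C of the first open support is `1 + 2^k p^m = q^n` (`p, q` odd primes).  For `n = ℓ` an odd prime we show,
by lifting the exponent, that `p ∤ q - 1`; hence `q - 1` is a power of two — `q` is a prime of Fermat type — and
`(q^ℓ - 1)/(q - 1) = p^m` is a Nagell–Ljunggren equation at a Fermat-prime base.  (If `p ∣ q - 1`, LTE gives
`v_p(Φ_ℓ(q)) ≤ 1` for `Φ_ℓ(q) = 1 + q + ⋯ + q^(ℓ-1)`, which is odd and supported on `{p}`, so `Φ_ℓ(q) ≤ p < q`, absurd.)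

* `fermat_prime_corner` : `2 ^ k * p ^ m + 1 = q ^ ℓ` (`p, q, ℓ` odd primes) implies `¬ p ∣ q - 1` and
  `∃ s, q = 2 ^ s + 1`.
-/

namespace Summit.ABC.ABC.Theorems

/-- Parity of a geometric sum with odd ratio: `∑_{i<n} q^i ≡ n (mod 2)`. -/
private theorem geom_sum_mod_two {q : ℕ} (hq : Odd q) (n : ℕ) :
    (∑ i ∈ Finset.range n, q ^ i) % 2 = n % 2 := by
  induction n with
  | zero => simp
  | succ n ih =>
    rw [Finset.sum_range_succ, Nat.add_mod, ih]
    have : q ^ n % 2 = 1 := Nat.odd_iff.mp hq.pow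
    rw [this]
    omega

/-- **Fermat-prime corner.** If `p, q, ℓ` are odd primes and `2^k p^m + 1 = q^ℓ`, then `p ∤ q - 1`, so `q - 1`
is a power of two. -/
theorem fermat_prime_corner {k m ℓ p q : ℕ} (hp : p.Prime) (hq : q.Prime) (hℓ : ℓ.Prime) (hp2 : p ≠ 2)
    (hq2 : q ≠ 2) (hℓ2 : ℓ ≠ 2) (h : 2 ^ k * p ^ m + 1 = q ^ ℓ) :
    ¬ p ∣ q - 1 ∧ ∃ s : ℕ, q = 2 ^ s + 1 := by
  haveI := Fact.mk hp
  have hp3 : 3 ≤ p := by have := hp.two_le; omega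
  have hq3 : 3 ≤ q := by have := hq.two_le; omega
  have hℓ3 : 3 ≤ ℓ := by have := hℓ.two_le; omega
  have hqℓ : q ^ ℓ - 1 = 2 ^ k * p ^ m := by omega
  -- the geometric sum `Φ = 1 + q + ⋯ + q^(ℓ-1)` and `(q - 1) Φ = q^ℓ - 1`
  set Φ := ∑ i ∈ Finset.range ℓ, q ^ i with hΦdef
  have hgeom : Φ = (q ^ ℓ - 1) / (q - 1) := Nat.geomSum_eq (by omega) ℓ
  have hdvd : q - 1 ∣ q ^ ℓ - 1 := Nat.sub_one_dvd_pow_sub_one q ℓ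
  have hΦ : (q - 1) * Φ = 2 ^ k * p ^ m := by rw [hgeom, Nat.mul_div_cancel' hdvd, hqℓ]
  have hΦodd : Φ % 2 = 1 := by
    rw [hΦdef, geom_sum_mod_two (hq.odd_of_ne_two hq2)]
    exact Nat.odd_iff.mp (hℓ.odd_of_ne_two hℓ2)
  have hΦbig : q + 1 ≤ Φ := by
    have : ∑ i ∈ Finset.range 2, q ^ i ≤ Φ :=
      Finset.sum_le_sum_of_subset (Finset.range_subset_range.mpr (by omega))
    simpa [Finset.sum_range_succ, add_comm] using this
  have hΦ0 : Φ ≠ 0 := by omega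
  -- every prime factor of `Φ` is `p` (it divides `2^k p^m` and `Φ` is odd)
  have hΦsupp : ∀ d : ℕ, d.Prime → d ∣ Φ → d = p := by
    intro d hd hdΦ
    have : d ∣ 2 ^ k * p ^ m := hΦ ▸ hdΦ.mul_left (q - 1)
    rcases (Nat.Prime.dvd_mul hd).mp this with h2 | hpm
    · have := (Nat.prime_dvd_prime_iff_eq hd Nat.prime_two).mp (hd.dvd_of_dvd_pow h2)
      subst this
      exfalso
      omega
    · exact (Nat.prime_dvd_prime_iff_eq hd hp).mp (hd.dvd_of_dvd_pow hpm)
  have hnot : ¬ p ∣ q - 1 := by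
    intro hpq
    -- LTE: `v_p(q^ℓ - 1) = v_p(q - 1) + v_p(ℓ)`
    have hpnq : ¬ p ∣ q := by
      intro h'
      have := (Nat.prime_dvd_prime_iff_eq hp hq).mp h'
      subst this
      have : p ∣ 1 := by
        have h1 : p ∣ (p - 1) + 1 := by rw [Nat.sub_add_cancel hp.one_le]
        exact (Nat.dvd_add_right hpq).mp h1
      exact hp.one_lt.ne' (Nat.dvd_one.mp this)
    have hlte := padicValNat.pow_sub_pow (hp.odd_of_ne_two hp2) (show 1 < q by omega)
      (by simpa using hpq) hpnq hℓ.ne_zero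
    rw [one_pow, hqℓ] at hlte
    have hv2 : padicValNat p (2 ^ k) = 0 := by
      apply padicValNat.eq_zero_of_not_dvd
      intro h'
      have := (Nat.prime_dvd_prime_iff_eq hp Nat.prime_two).mp (hp.dvd_of_dvd_pow h')
      omega
    have hvm : padicValNat p (2 ^ k * p ^ m) = m := by
      rw [padicValNat.mul (by positivity) (by positivity), hv2, padicValNat.prime_pow, zero_add]
    have hvℓ : padicValNat p ℓ ≤ 1 := by
      by_cases hpl : p = ℓ
      · subst hpl; rw [padicValNat_self]
      · rw [padicValNat.eq_zero_of_not_dvd]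
        · exact zero_le_one
        · intro h'; exact hpl ((Nat.prime_dvd_prime_iff_eq hp hℓ).mp h')
    -- `v_p((q-1) Φ) = m`, so `v_p(Φ) = m - v_p(q-1) ≤ 1`
    have hvprod : padicValNat p (q - 1) + padicValNat p Φ = m := by
      rw [← padicValNat.mul (by omega) hΦ0, hΦ, hvm]
    obtain ⟨j, hj⟩ : ∃ j, Φ = p ^ j := ⟨_, Nat.eq_prime_pow_of_unique_prime_dvd hΦ0 (hΦsupp _)⟩
    have hjv : padicValNat p Φ = j := by rw [hj, padicValNat.prime_pow]
    have hj1 : j ≤ 1 := by omega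
    -- so `Φ ≤ p ≤ q - 1 < q + 1 ≤ Φ`
    have hΦle : Φ ≤ p := by
      rw [hj]
      calc p ^ j ≤ p ^ 1 := Nat.pow_le_pow_right hp.pos hj1
        _ = p := pow_one p
    have hple : p ≤ q - 1 := Nat.le_of_dvd (by omega) hpq
    omega
  refine ⟨hnot, ?_⟩
  -- `q - 1` divides `2^k p^m` and is prime to `p`, hence a power of two
  have hq1supp : ∀ d : ℕ, d.Prime → d ∣ q - 1 → d = 2 := by
    intro d hd hdq
    have : d ∣ 2 ^ k * p ^ m := hΦ ▸ hdq.mul_right Φ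
    rcases (Nat.Prime.dvd_mul hd).mp this with h2 | hpm
    · exact (Nat.prime_dvd_prime_iff_eq hd Nat.prime_two).mp (hd.dvd_of_dvd_pow h2)
    · have := (Nat.prime_dvd_prime_iff_eq hd hp).mp (hd.dvd_of_dvd_pow hpm)
      subst this
      exact absurd hdq hnot
  obtain ⟨s, hs⟩ : ∃ s, q - 1 = 2 ^ s := ⟨_, Nat.eq_prime_pow_of_unique_prime_dvd (by omega) (hq1supp _)⟩
  exact ⟨s, by omega⟩

end Summit.ABC.ABC.Theorems
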